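import Mathlib
import Summits.NavierStokesRegularity.NavierStokesRegularity.Theorems.TaoLadderRungTwoBreakBlowupRigidityOneSmallEnvelope
import HarnessLib

/-!
# The CRITICAL envelope `δ(1+ε₀)^{-k/2}` is forward-invariant under the NS-damped lattice from ANY (4.5)-bounded
  multi-shell state once `8 m² M_α δ < ν` — scale-invariant small-critical-data persistence, uniform over all shells
  `k ∈ ℤ` (no «no low shells» hypothesis), for the absorber constructions behind the survival step (E2) of
  `stub_eternalFromBlowup` (K2(1) `TaoLadderRungTwoBreak.BlowupRigidityOne`, stmt-NavierStokesRegularity-20206)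

MODEL lattice ODEs only (Tao 2016 §4 Lemma 4.1 (4.5), (4.8) and the viscous lattice before Thm. 4.2); nothing here is a
statement about the Navier–Stokes equations; NO item is closed (`--supports stmt-NavierStokesRegularity-20206`).
Route-independent module; general `m`; DEF-FREE.

The (S₁)-criticality of a shell is `(1+ε₀)^k‖X_k‖²`; the envelope `|X_{i,k}| ≤ δ(1+ε₀)^{-k/2}` says «every shell is
(S₁)-quiet at level `δ²`». At this weight the competition nonlinearity : dissipation is SHELL-INDEPENDENT:
`|quadTerm_{i,n}| ≤ 4 m² M_α δ² (1+ε₀)^{3n/2}` against `ν(1+ε₀)^{2n} · (δ/2)(1+ε₀)^{-n/2}`, ratio `8 m² M_α δ/ν` for every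
`n ∈ ℤ` — the lattice form of «small critical data stay small» (compare the weight `(1+ε₀)^{-9k}` of `…SmallEnvelope`,
whose ratio improves with `n` but needs `n ≥ 0`).

* `critical_shift_exponent_le`, `abs_quadTerm_le_of_criticalEnvelope` — the monomial bookkeeping at the critical weight;
* `criticalEnvelope_improves` — THE FENCE at the critical weight, from a MULTI-SHELL state: envelope `δ` on `[0,s]` and
  `δ/2` at time `0` ⇒ `δ/2` on `[0,s]`, provided `8 m² M_α δ < ν`;
* `criticalEnvelope_persists` — PERSISTENCE by continuous induction for (4.5)-bounded continuous solutions on `[0,s]`: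
  the critical envelope with `δ/2` at time `0` (all shells) propagates as the envelope `δ` to all of `[0,s]` (only
  finitely many shells `|k| < K₀` are not automatically inside, by the (4.5) bound above and plain boundedness below).

USE. Restarted at a time where a blow-up front has thinned out to (S₁)-level `< (ν/(16 m² M_α))²` on all shells, the
`ν`-damped continuation never regains a louder shell: the quantitative form of «a sub-threshold state is absorbed», the
input an (E2)-by-construction argument needs before the smoothing/continuation step. HONEST LABEL: an a priori estimate
for the damped MODEL lattice (BMR-type invariant region at the critical weight); no stub, crux or summit is proved; rung 0.
-/

noncomputable section

-- the summit and its single sub-problem share the name (CONVENTIONS §1)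
set_option linter.dupNamespace false

open Set Filter Topology

namespace Summit.NavierStokesRegularity.NavierStokesRegularity.Theorems

namespace BlowupRigidityOne

open Literature.Analysis.FluidPDE Literature.Analysis.FluidPDE.TaoCascade

variable {m : ℕ}

/-- Exponent bookkeeping of one monomial at the critical weight `(1+ε₀)^{-k/2}`:
`5(n−μ₃)/2 − (n−μ₃+μ₁)/2 − (n−μ₃+μ₂)/2 ≤ 3n/2` on Tao's shift set. [cite: Tao2016AveragedNS, §4 (4.1), (4.8)] -/
theorem critical_shift_exponent_le {μ : ℤ × ℤ × ℤ} (hμ : μ ∈ shiftSet) (n : ℤ) :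
    (5 : ℝ) * ((n : ℝ) - (μ.2.2 : ℝ)) / 2 + -((1 / 2 : ℝ) * (((n - μ.2.2 + μ.1 : ℤ)) : ℝ))
        + -((1 / 2 : ℝ) * (((n - μ.2.2 + μ.2.1 : ℤ)) : ℝ)) ≤ (3 / 2 : ℝ) * n := by
  rcases (mem_shiftSet_iff μ).1 hμ with rfl | rfl | rfl | rfl <;> push_cast <;> nlinarith

/-- **The nonlinearity under the critical envelope.** If `|α| ≤ M_α` and `|X_{j,k}(t)| ≤ δ(1+ε₀)^{-k/2}` for all modes and
ALL shells `k ∈ ℤ` at time `t` (`ε₀ > 0`, `δ ≥ 0`), then `|quadTerm_{i,n}(X)(t)| ≤ 4 m² M_α δ² (1+ε₀)^{3n/2}`.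
[cite: Tao2016AveragedNS, §4 (4.1), Lemma 4.1 (4.8)] -/
theorem abs_quadTerm_le_of_criticalEnvelope {ε₀ Mα δ : ℝ} (hε : 0 < ε₀) (hδ : 0 ≤ δ)
    {α : Fin m → Fin m → Fin m → ℤ × ℤ × ℤ → ℝ} (hα : ∀ i₁ i₂ i₃ μ, |α i₁ i₂ i₃ μ| ≤ Mα)
    {X : Fin m → ℤ → ℝ → ℝ} {t : ℝ}
    (henv : ∀ (j : Fin m) (k : ℤ), |X j k t| ≤ δ * (1 + ε₀) ^ (-((1 / 2 : ℝ) * k))) (i : Fin m) (n : ℤ) :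
    |quadTerm ε₀ α X i n t| ≤ 4 * (m : ℝ) ^ 2 * Mα * δ ^ 2 * (1 + ε₀) ^ ((3 / 2 : ℝ) * n) := by
  have hb : 0 < 1 + ε₀ := by linarith
  have hb1 : 1 ≤ 1 + ε₀ := by linarith
  have hMα : 0 ≤ Mα := by
    rcases Nat.eq_zero_or_pos m with h | h
    · exact absurd i.isLt (by omega)
    · exact (abs_nonneg _).trans (hα i i i (0, 0, 0))
  set W : ℝ := Mα * δ ^ 2 * (1 + ε₀) ^ ((3 / 2 : ℝ) * n) with hW
  have hterm : ∀ (i₁ i₂ : Fin m), ∀ μ ∈ shiftSet,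
      |α i₁ i₂ i μ * (1 + ε₀) ^ ((5 : ℝ) * (n - μ.2.2) / 2) *
          (X i₁ (n - μ.2.2 + μ.1) t * X i₂ (n - μ.2.2 + μ.2.1) t)| ≤ W := by
    intro i₁ i₂ μ hμ
    have hp : 0 < (1 + ε₀) ^ ((5 : ℝ) * (n - μ.2.2) / 2) := Real.rpow_pos_of_pos hb _
    rw [abs_mul, abs_mul, abs_mul, abs_of_pos hp]
    have h1 := henv i₁ (n - μ.2.2 + μ.1)
    have h2 := henv i₂ (n - μ.2.2 + μ.2.1)
    have hq1 : 0 ≤ δ * (1 + ε₀) ^ (-((1 / 2 : ℝ) * ((n - μ.2.2 + μ.1 : ℤ) : ℝ))) :=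
      mul_nonneg hδ (Real.rpow_nonneg hb.le _)
    calc |α i₁ i₂ i μ| * (1 + ε₀) ^ ((5 : ℝ) * (n - μ.2.2) / 2) *
          (|X i₁ (n - μ.2.2 + μ.1) t| * |X i₂ (n - μ.2.2 + μ.2.1) t|)
        ≤ Mα * (1 + ε₀) ^ ((5 : ℝ) * (n - μ.2.2) / 2) *
          ((δ * (1 + ε₀) ^ (-((1 / 2 : ℝ) * ((n - μ.2.2 + μ.1 : ℤ) : ℝ)))) *
            (δ * (1 + ε₀) ^ (-((1 / 2 : ℝ) * ((n - μ.2.2 + μ.2.1 : ℤ) : ℝ))))) :=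
          mul_le_mul (mul_le_mul_of_nonneg_right (hα i₁ i₂ i μ) hp.le)
            (mul_le_mul h1 h2 (abs_nonneg _) hq1) (mul_nonneg (abs_nonneg _) (abs_nonneg _))
            (mul_nonneg hMα hp.le)
      _ = Mα * δ ^ 2 * ((1 + ε₀) ^ ((5 : ℝ) * (n - μ.2.2) / 2) *
            (1 + ε₀) ^ (-((1 / 2 : ℝ) * ((n - μ.2.2 + μ.1 : ℤ) : ℝ))) *
            (1 + ε₀) ^ (-((1 / 2 : ℝ) * ((n - μ.2.2 + μ.2.1 : ℤ) : ℝ)))) := by ring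
      _ = Mα * δ ^ 2 * (1 + ε₀) ^ ((5 : ℝ) * (n - μ.2.2) / 2 +
            -((1 / 2 : ℝ) * ((n - μ.2.2 + μ.1 : ℤ) : ℝ)) + -((1 / 2 : ℝ) * ((n - μ.2.2 + μ.2.1 : ℤ) : ℝ))) := by
          rw [Real.rpow_add hb, Real.rpow_add hb]
      _ ≤ Mα * δ ^ 2 * (1 + ε₀) ^ ((3 / 2 : ℝ) * n) := by
          apply mul_le_mul_of_nonneg_left _ (mul_nonneg hMα (sq_nonneg δ))
          exact Real.rpow_le_rpow_of_exponent_le hb1 (critical_shift_exponent_le hμ n)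
  unfold quadTerm
  calc |∑ i₁, ∑ i₂, ∑ μ ∈ shiftSet, α i₁ i₂ i μ * (1 + ε₀) ^ ((5 : ℝ) * (n - μ.2.2) / 2) *
          (X i₁ (n - μ.2.2 + μ.1) t * X i₂ (n - μ.2.2 + μ.2.1) t)|
      ≤ ∑ i₁, |∑ i₂, ∑ μ ∈ shiftSet, α i₁ i₂ i μ * (1 + ε₀) ^ ((5 : ℝ) * (n - μ.2.2) / 2) *
          (X i₁ (n - μ.2.2 + μ.1) t * X i₂ (n - μ.2.2 + μ.2.1) t)| := Finset.abs_sum_le_sum_abs _ _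
    _ ≤ ∑ i₁ : Fin m, ∑ i₂ : Fin m, ((4 : ℝ) * W) := by
        refine Finset.sum_le_sum fun i₁ _ => ?_
        refine (Finset.abs_sum_le_sum_abs _ _).trans (Finset.sum_le_sum fun i₂ _ => ?_)
        refine (Finset.abs_sum_le_sum_abs _ _).trans ?_
        calc ∑ μ ∈ shiftSet, |α i₁ i₂ i μ * (1 + ε₀) ^ ((5 : ℝ) * (n - μ.2.2) / 2) *
              (X i₁ (n - μ.2.2 + μ.1) t * X i₂ (n - μ.2.2 + μ.2.1) t)|
            ≤ ∑ μ ∈ shiftSet, W := Finset.sum_le_sum fun μ hμ => hterm i₁ i₂ μ hμ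
          _ = 4 * W := by rw [Finset.sum_const, card_shiftSet, nsmul_eq_mul]; norm_num
    _ = 4 * (m : ℝ) ^ 2 * Mα * δ ^ 2 * (1 + ε₀) ^ ((3 / 2 : ℝ) * n) := by
        rw [Finset.sum_const, Finset.sum_const, Finset.card_univ, Fintype.card_fin, nsmul_eq_mul, nsmul_eq_mul,
          hW]
        ring

/-- **THE FENCE AT THE CRITICAL WEIGHT, from a multi-shell state.** Let `ε₀ > 0`, `|α| ≤ M_α`, `0 < δ`,
`8 m² M_α δ < ν`. Let `X` be continuous on `[0,s]` shell-wise and solve the `ν`-viscous lattice on `[0,s]` (one-sided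
derivatives within `[0,s]`), with `|X_{i,k}(0)| ≤ (δ/2)(1+ε₀)^{-k/2}` and the envelope `|X_{i,k}(t)| ≤ δ(1+ε₀)^{-k/2}` on
`[0,s]`, for all modes and ALL shells `k ∈ ℤ`. Then `|X_{i,k}(t)| ≤ (δ/2)(1+ε₀)^{-k/2}` on `[0,s]`: at contact the
dissipation `ν(1+ε₀)^{2k}X²` beats `|X|·|quadTerm|` by the shell-independent ratio `8 m² M_α δ/ν < 1`.
[cite: Tao2016AveragedNS, §4 Lemma 4.1 (4.8) and the viscous lattice before Thm. 4.2; BarbatoMorandinRomito2011, §3.1 Prop. 3.3] -/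
theorem criticalEnvelope_improves {ε₀ ν Mα δ s : ℝ} (hε : 0 < ε₀) (hδ : 0 < δ)
    {α : Fin m → Fin m → Fin m → ℤ × ℤ × ℤ → ℝ} (hα : ∀ i₁ i₂ i₃ μ, |α i₁ i₂ i₃ μ| ≤ Mα)
    (hsmall : 8 * (m : ℝ) ^ 2 * Mα * δ < ν)
    {X : Fin m → ℤ → ℝ → ℝ}
    (h0 : ∀ (i : Fin m) (k : ℤ), |X i k 0| ≤ δ / 2 * (1 + ε₀) ^ (-((1 / 2 : ℝ) * k)))
    (hcont : ∀ i k, ContinuousOn (X i k) (Icc 0 s))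
    (hderiv : ∀ i k, ∀ t ∈ Icc 0 s, HasDerivWithinAt (X i k)
      (quadTerm ε₀ α X i k t - ν * (1 + ε₀) ^ ((2 : ℝ) * k) * X i k t) (Icc 0 s) t)
    (henv : ∀ (i : Fin m) (k : ℤ), ∀ t ∈ Icc 0 s, |X i k t| ≤ δ * (1 + ε₀) ^ (-((1 / 2 : ℝ) * k))) :
    ∀ (i : Fin m) (k : ℤ), ∀ t ∈ Icc 0 s, |X i k t| ≤ δ / 2 * (1 + ε₀) ^ (-((1 / 2 : ℝ) * k)) := by
  intro i k t ht
  have hb : 0 < 1 + ε₀ := by linarith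
  set e : ℝ := δ / 2 * (1 + ε₀) ^ (-((1 / 2 : ℝ) * k)) with he_def
  have he : 0 < e := by positivity
  have hMα : 0 ≤ Mα := by
    rcases Nat.eq_zero_or_pos m with h | h
    · exact absurd i.isLt (by omega)
    · exact (abs_nonneg _).trans (hα i i i (0, 0, 0))
  set D : ℝ → ℝ := fun x => quadTerm ε₀ α X i k x - ν * (1 + ε₀) ^ ((2 : ℝ) * k) * X i k x with hD
  have hf' : ∀ x ∈ Ico 0 s, HasDerivWithinAt (fun y => X i k y * X i k y)
      (D x * X i k x + X i k x * D x) (Ici x) x := by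
    intro x hx
    have h1 : HasDerivWithinAt (X i k) (D x) (Ici x) x :=
      (hderiv i k x (Ico_subset_Icc_self hx)).mono_of_mem_nhdsWithin (Icc_mem_nhdsGE_of_mem hx)
    exact h1.mul h1
  have hfc : ContinuousOn (fun y => X i k y * X i k y) (Icc 0 s) := (hcont i k).mul (hcont i k)
  have h0' : X i k 0 * X i k 0 ≤ e ^ 2 := by
    have h2 : X i k 0 * X i k 0 = |X i k 0| ^ 2 := by rw [sq_abs]; ring
    rw [h2]
    exact pow_le_pow_left₀ (abs_nonneg _) (h0 i k) 2
  have hbound : ∀ x ∈ Ico 0 s, X i k x * X i k x = e ^ 2 → D x * X i k x + X i k x * D x < 0 := by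
    intro x hx hcontact
    have hxI : x ∈ Icc 0 s := Ico_subset_Icc_self hx
    have habs : |X i k x| = e := by
      have h2 : |X i k x| ^ 2 = e ^ 2 := by rw [sq_abs, sq]; exact hcontact
      exact (pow_left_inj₀ (abs_nonneg _) he.le two_ne_zero).1 h2
    have hq := abs_quadTerm_le_of_criticalEnvelope hε hδ.le hα (fun j k' => henv j k' x hxI) i k
    have hlam : 0 < (1 + ε₀) ^ ((2 : ℝ) * k) := Real.rpow_pos_of_pos hb _
    -- the shell-independent competition: `(1+ε₀)^{3k/2} = (1+ε₀)^{2k} (1+ε₀)^{-k/2}`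
    have hexp : (1 + ε₀) ^ ((3 / 2 : ℝ) * k) = (1 + ε₀) ^ ((2 : ℝ) * k) * (1 + ε₀) ^ (-((1 / 2 : ℝ) * k)) := by
      rw [← Real.rpow_add hb]; congr 1; ring
    have hkey : 4 * (m : ℝ) ^ 2 * Mα * δ ^ 2 * (1 + ε₀) ^ ((3 / 2 : ℝ) * k)
        < ν * (1 + ε₀) ^ ((2 : ℝ) * k) * e := by
      calc 4 * (m : ℝ) ^ 2 * Mα * δ ^ 2 * (1 + ε₀) ^ ((3 / 2 : ℝ) * k)
          = (8 * (m : ℝ) ^ 2 * Mα * δ) * ((1 + ε₀) ^ ((2 : ℝ) * k) * e) := by rw [hexp, he_def]; ring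
        _ < ν * ((1 + ε₀) ^ ((2 : ℝ) * k) * e) := mul_lt_mul_of_pos_right hsmall (mul_pos hlam he)
        _ = ν * (1 + ε₀) ^ ((2 : ℝ) * k) * e := by ring
    have hXq : X i k x * quadTerm ε₀ α X i k x ≤ e * (4 * (m : ℝ) ^ 2 * Mα * δ ^ 2 *
        (1 + ε₀) ^ ((3 / 2 : ℝ) * k)) := by
      calc X i k x * quadTerm ε₀ α X i k x ≤ |X i k x * quadTerm ε₀ α X i k x| := le_abs_self _
        _ = |X i k x| * |quadTerm ε₀ α X i k x| := abs_mul _ _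
        _ ≤ e * (4 * (m : ℝ) ^ 2 * Mα * δ ^ 2 * (1 + ε₀) ^ ((3 / 2 : ℝ) * k)) := by
            rw [habs]; exact mul_le_mul_of_nonneg_left hq he.le
    have hsq : X i k x * X i k x = e * e := by rw [hcontact, sq]
    have : D x * X i k x + X i k x * D x
        = 2 * (X i k x * quadTerm ε₀ α X i k x) - 2 * (ν * (1 + ε₀) ^ ((2 : ℝ) * k)) * (X i k x * X i k x) := by
      rw [hD]; ring
    rw [this, hsq]
    nlinarith [hkey, hXq, he, hlam]
  have hle := image_le_of_deriv_right_lt_deriv_boundary hfc hf' (B := fun _ => e ^ 2) (B' := fun _ => 0) h0'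
    (fun x => hasDerivAt_const x (e ^ 2)) hbound ht
  have h2 : (X i k t) ^ 2 ≤ e ^ 2 := by rw [sq]; exact hle
  exact abs_le_of_sq_le_sq h2 he.le

/-- **PERSISTENCE OF THE CRITICAL ENVELOPE along (4.5)-bounded solutions.** Let `ε₀ > 0`, `|α| ≤ M_α`, `0 < δ`,
`8 m² M_α δ < ν`. Let `X` be continuous shell-wise, bounded with the a priori weight
(`sup_{t,i,k} (1+(1+ε₀)^{10k})|X_{i,k}(t)| < ∞`), solve the `ν`-viscous lattice on `[0,s]` (`s ≥ 0`), and start inside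
the half envelope: `|X_{i,k}(0)| ≤ (δ/2)(1+ε₀)^{-k/2}` for all `i` and ALL `k ∈ ℤ` (a multi-shell state). Then
`|X_{i,k}(t)| ≤ δ(1+ε₀)^{-k/2}` on `[0,s]` for all modes and shells.
[cite: Tao2016AveragedNS, §4 Lemma 4.1 (4.5), (4.8) and the viscous lattice before Thm. 4.2; BarbatoMorandinRomito2011, §3.1 Prop. 3.3] -/
theorem criticalEnvelope_persists {ε₀ ν Mα δ s : ℝ} (hε : 0 < ε₀) (hδ : 0 < δ)
    {α : Fin m → Fin m → Fin m → ℤ × ℤ × ℤ → ℝ} (hα : ∀ i₁ i₂ i₃ μ, |α i₁ i₂ i₃ μ| ≤ Mα)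
    (hsmall : 8 * (m : ℝ) ^ 2 * Mα * δ < ν)
    {X : Fin m → ℤ → ℝ → ℝ} (hs : 0 ≤ s)
    (h0 : ∀ (i : Fin m) (k : ℤ), |X i k 0| ≤ δ / 2 * (1 + ε₀) ^ (-((1 / 2 : ℝ) * k)))
    (hapriori : ∃ M : ℝ, ∀ (t : ℝ) (i : Fin m) (k : ℤ), (1 + (1 + ε₀) ^ ((10 : ℝ) * k)) * |X i k t| ≤ M)
    (hcontR : ∀ i k, Continuous (X i k))
    (hderiv : ∀ i k, ∀ t ∈ Icc 0 s, HasDerivWithinAt (X i k)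
      (quadTerm ε₀ α X i k t - ν * (1 + ε₀) ^ ((2 : ℝ) * k) * X i k t) (Icc 0 s) t) :
    ∀ (i : Fin m) (k : ℤ), ∀ t ∈ Icc 0 s, |X i k t| ≤ δ * (1 + ε₀) ^ (-((1 / 2 : ℝ) * k)) := by
  have hb : 0 < 1 + ε₀ := by linarith
  have hb1 : 1 ≤ 1 + ε₀ := by linarith
  have hb1' : 1 < 1 + ε₀ := by linarith
  obtain ⟨M, hM⟩ := hapriori
  -- automatic shells: `|k| ≥ K₀`
  obtain ⟨K₀, hK₀⟩ : ∃ K₀ : ℕ, M ≤ δ * (1 + ε₀) ^ ((K₀ : ℝ) / 2) := by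
    obtain ⟨K, hK⟩ := pow_unbounded_of_one_lt (M / δ) hb1'
    refine ⟨2 * K, ?_⟩
    have : ((2 * K : ℕ) : ℝ) / 2 = (K : ℝ) := by push_cast; ring
    rw [this, Real.rpow_natCast]
    exact ((div_lt_iff₀' hδ).1 hK).le
  have hauto : ∀ (t : ℝ) (i : Fin m) (k : ℤ), (K₀ : ℤ) ≤ k ∨ k ≤ -(K₀ : ℤ) →
      |X i k t| ≤ δ * (1 + ε₀) ^ (-((1 / 2 : ℝ) * k)) := by
    intro t i k hk
    have hw : 0 < (1 + ε₀) ^ ((10 : ℝ) * k) := Real.rpow_pos_of_pos hb _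
    have hXM : |X i k t| ≤ M := by
      have := hM t i k; nlinarith [abs_nonneg (X i k t)]
    have hXM' : (1 + ε₀) ^ ((10 : ℝ) * k) * |X i k t| ≤ M := by
      have := hM t i k; nlinarith [abs_nonneg (X i k t)]
    rcases hk with hk | hk
    · -- high shell: `(1+ε₀)^{10k}|X| ≤ M ≤ δ(1+ε₀)^{K₀/2} ≤ δ (1+ε₀)^{10k − k/2}`
      have hkr : (K₀ : ℝ) ≤ (k : ℝ) := by exact_mod_cast hk
      have hpK : 0 < (1 + ε₀) ^ ((K₀ : ℝ) / 2) := Real.rpow_pos_of_pos hb _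
      have hpk : 0 < (1 + ε₀) ^ (-((1 / 2 : ℝ) * k)) := Real.rpow_pos_of_pos hb _
      have hinv : (1 + ε₀) ^ (-((1 / 2 : ℝ) * k)) * (1 + ε₀) ^ ((1 / 2 : ℝ) * k) = 1 := by
        rw [← Real.rpow_add hb, neg_add_cancel, Real.rpow_zero]
      have hK0 : (0 : ℝ) ≤ (K₀ : ℝ) := Nat.cast_nonneg K₀
      have hsplit' : (1 + ε₀) ^ ((10 : ℝ) * k)
          = (1 + ε₀) ^ ((10 : ℝ) * k - (K₀ : ℝ) / 2 - (1 / 2 : ℝ) * k) *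
            ((1 + ε₀) ^ ((K₀ : ℝ) / 2) * (1 + ε₀) ^ ((1 / 2 : ℝ) * k)) := by
        rw [← Real.rpow_add hb, ← Real.rpow_add hb]; congr 1; ring
      have hbig' : 1 ≤ (1 + ε₀) ^ ((10 : ℝ) * k - (K₀ : ℝ) / 2 - (1 / 2 : ℝ) * k) :=
        Real.one_le_rpow hb1 (by nlinarith [hkr, hK0])
      have hpos3 : 0 < (1 + ε₀) ^ ((K₀ : ℝ) / 2) * (1 + ε₀) ^ ((1 / 2 : ℝ) * k) := by positivity
      have h4 : (1 + ε₀) ^ ((K₀ : ℝ) / 2) * (1 + ε₀) ^ ((1 / 2 : ℝ) * k) * |X i k t| ≤ M := by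
        have hX0 : 0 ≤ |X i k t| := abs_nonneg _
        calc (1 + ε₀) ^ ((K₀ : ℝ) / 2) * (1 + ε₀) ^ ((1 / 2 : ℝ) * k) * |X i k t|
            = 1 * ((1 + ε₀) ^ ((K₀ : ℝ) / 2) * (1 + ε₀) ^ ((1 / 2 : ℝ) * k) * |X i k t|) := by ring
          _ ≤ (1 + ε₀) ^ ((10 : ℝ) * k - (K₀ : ℝ) / 2 - (1 / 2 : ℝ) * k) *
                ((1 + ε₀) ^ ((K₀ : ℝ) / 2) * (1 + ε₀) ^ ((1 / 2 : ℝ) * k) * |X i k t|) :=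
              mul_le_mul_of_nonneg_right hbig' (mul_nonneg hpos3.le hX0)
          _ = (1 + ε₀) ^ ((10 : ℝ) * k) * |X i k t| := by rw [hsplit']; ring
          _ ≤ M := hXM'
      have h5 : (1 + ε₀) ^ ((1 / 2 : ℝ) * k) * |X i k t| ≤ δ := by
        have := h4.trans hK₀
        have h3 : (1 + ε₀) ^ ((K₀ : ℝ) / 2) * ((1 + ε₀) ^ ((1 / 2 : ℝ) * k) * |X i k t|)
            ≤ (1 + ε₀) ^ ((K₀ : ℝ) / 2) * δ := by rw [← mul_assoc, mul_comm _ δ]; exact this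
        exact le_of_mul_le_mul_left h3 hpK
      calc |X i k t| = (1 + ε₀) ^ (-((1 / 2 : ℝ) * k)) * ((1 + ε₀) ^ ((1 / 2 : ℝ) * k) * |X i k t|) := by
            rw [← mul_assoc, hinv, one_mul]
        _ ≤ (1 + ε₀) ^ (-((1 / 2 : ℝ) * k)) * δ := mul_le_mul_of_nonneg_left h5 hpk.le
        _ = δ * (1 + ε₀) ^ (-((1 / 2 : ℝ) * k)) := mul_comm _ _
    · -- low (very negative) shell: `|X| ≤ M ≤ δ (1+ε₀)^{K₀/2} ≤ δ (1+ε₀)^{-k/2}`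
      have hkr : (k : ℝ) ≤ -(K₀ : ℝ) := by exact_mod_cast hk
      calc |X i k t| ≤ M := hXM
        _ ≤ δ * (1 + ε₀) ^ ((K₀ : ℝ) / 2) := hK₀
        _ ≤ δ * (1 + ε₀) ^ (-((1 / 2 : ℝ) * k)) :=
            mul_le_mul_of_nonneg_left (Real.rpow_le_rpow_of_exponent_le hb1 (by nlinarith [hkr])) hδ.le
  -- the envelope at a time from its middle shells `-K₀ < k < K₀`
  have hall : ∀ t, (∀ (i : Fin m) (k : ℤ), -(K₀ : ℤ) < k → k < (K₀ : ℤ) →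
      |X i k t| ≤ δ * (1 + ε₀) ^ (-((1 / 2 : ℝ) * k))) →
      ∀ (i : Fin m) (k : ℤ), |X i k t| ≤ δ * (1 + ε₀) ^ (-((1 / 2 : ℝ) * k)) := by
    intro t hmid i k
    by_cases h1 : (K₀ : ℤ) ≤ k
    · exact hauto t i k (Or.inl h1)
    by_cases h2 : k ≤ -(K₀ : ℤ)
    · exact hauto t i k (Or.inr h2)
    exact hmid i k (not_le.1 h2) (not_le.1 h1)
  -- envelope at time 0 (from the half envelope)
  have h0env : ∀ (i : Fin m) (k : ℤ), |X i k 0| ≤ δ * (1 + ε₀) ^ (-((1 / 2 : ℝ) * k)) := fun i k =>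
    (h0 i k).trans (by
      have : 0 ≤ (1 + ε₀) ^ (-((1 / 2 : ℝ) * k)) := Real.rpow_nonneg hb.le _
      nlinarith)
  -- continuous induction
  set S : Set ℝ := {τ | τ ∈ Icc 0 s ∧ ∀ (i : Fin m) (k : ℤ), ∀ t ∈ Icc 0 τ,
    |X i k t| ≤ δ * (1 + ε₀) ^ (-((1 / 2 : ℝ) * k))} with hS
  have h0S : (0 : ℝ) ∈ S := by
    refine ⟨⟨le_rfl, hs⟩, fun i k t ht => ?_⟩
    have : t = 0 := le_antisymm ht.2 ht.1
    rw [this]; exact h0env i k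
  have hne : S.Nonempty := ⟨0, h0S⟩
  have hbdd : BddAbove S := ⟨s, fun τ hτ => hτ.1.2⟩
  set τs := sSup S with hτs
  have hτs0 : 0 ≤ τs := le_csSup hbdd h0S
  have hτss : τs ≤ s := csSup_le hne fun τ hτ => hτ.1.2
  have hbelow : ∀ t, 0 ≤ t → t < τs → ∀ (i : Fin m) (k : ℤ), |X i k t| ≤ δ * (1 + ε₀) ^ (-((1 / 2 : ℝ) * k)) := by
    intro t ht0 ht i k
    obtain ⟨τ, hτS, htτ⟩ := exists_lt_of_lt_csSup hne ht
    exact hτS.2 i k t ⟨ht0, htτ.le⟩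
  have hat : ∀ (i : Fin m) (k : ℤ), |X i k τs| ≤ δ * (1 + ε₀) ^ (-((1 / 2 : ℝ) * k)) := by
    intro i k
    rcases hτs0.eq_or_lt with h0' | hpos
    · rw [← h0']; exact h0env i k
    · have hclosed : IsClosed {t | |X i k t| ≤ δ * (1 + ε₀) ^ (-((1 / 2 : ℝ) * k))} :=
        isClosed_le (hcontR i k).abs continuous_const
      have hsub : Ico 0 τs ⊆ {t | |X i k t| ≤ δ * (1 + ε₀) ^ (-((1 / 2 : ℝ) * k))} :=
        fun t ht => hbelow t ht.1 ht.2 i k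
      have hcl := hclosed.closure_subset_iff.2 hsub
      rw [closure_Ico hpos.ne] at hcl
      exact hcl ⟨hτs0, le_rfl⟩
  have hτsS : τs ∈ S := by
    refine ⟨⟨hτs0, hτss⟩, fun i k t ht => ?_⟩
    rcases ht.2.eq_or_lt with h | h
    · rw [h]; exact hat i k
    · exact hbelow t ht.1 h i k
  rcases hτss.eq_or_lt with hEq | hlt
  · intro i k t ht
    rw [← hEq] at ht
    exact hτsS.2 i k t ht
  exfalso
  have hderiv' : ∀ i k, ∀ t ∈ Icc 0 τs, HasDerivWithinAt (X i k)
      (quadTerm ε₀ α X i k t - ν * (1 + ε₀) ^ ((2 : ℝ) * k) * X i k t) (Icc 0 τs) t :=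
    fun i k t ht => (hderiv i k t ⟨ht.1, ht.2.trans hτss⟩).mono (Icc_subset_Icc_right hτss)
  have himp := criticalEnvelope_improves (s := τs) hε hδ hα hsmall h0
    (fun i k => (hcontR i k).continuousOn) hderiv' hτsS.2
  -- the finitely many middle shells stay strictly inside for a while after `τs`
  have hev : ∀ᶠ t in 𝓝 τs, ∀ (i : Fin m) (j : Fin (2 * K₀ + 1)),
      |X i ((j : ℕ) - (K₀ : ℤ)) t| < δ * (1 + ε₀) ^ (-((1 / 2 : ℝ) * ((((j : ℕ) : ℤ) - (K₀ : ℤ) : ℤ) : ℝ))) := by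
    refine eventually_all.2 fun i => eventually_all.2 fun j => ?_
    refine ((hcontR i _).abs.continuousAt).eventually_lt continuousAt_const ?_
    have h1 := himp i (((j : ℕ) : ℤ) - (K₀ : ℤ)) τs ⟨hτs0, le_rfl⟩
    have hpos : 0 < δ * (1 + ε₀) ^ (-((1 / 2 : ℝ) * ((((j : ℕ) : ℤ) - (K₀ : ℤ) : ℤ) : ℝ))) :=
      mul_pos hδ (Real.rpow_pos_of_pos hb _)
    linarith
  obtain ⟨η, hη, hball⟩ := Metric.eventually_nhds_iff.1 hev
  set τ' := min s (τs + η / 2) with hτ'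
  have hτ'gt : τs < τ' := lt_min hlt (by linarith)
  have hτ'S : τ' ∈ S := by
    refine ⟨⟨hτs0.trans hτ'gt.le, min_le_left _ _⟩, fun i k t ht => ?_⟩
    rcases le_or_gt t τs with hle | hgt
    · exact hτsS.2 i k t ⟨ht.1, hle⟩
    · refine hall t (fun i' k' hk1 hk2 => ?_) i k
      have hdist : dist t τs < η := by
        rw [Real.dist_eq, abs_of_pos (by linarith)]
        have : t ≤ τs + η / 2 := ht.2.trans (min_le_right _ _)
        linarith
      -- index `j = k' + K₀ ∈ [0, 2K₀]`
      obtain ⟨j, hj⟩ : ∃ j : ℕ, (j : ℤ) = k' + K₀ := ⟨(k' + K₀).toNat, Int.toNat_of_nonneg (by omega)⟩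
      have hjlt : j < 2 * K₀ + 1 := by omega
      have hk' : k' = ((⟨j, hjlt⟩ : Fin (2 * K₀ + 1)) : ℕ) - (K₀ : ℤ) := by simp; omega
      have := hball hdist i' ⟨j, hjlt⟩
      rw [hk']
      exact this.le
  exact absurd (le_csSup hbdd hτ'S) (not_le.2 hτ'gt)

end BlowupRigidityOne

end Summit.NavierStokesRegularity.NavierStokesRegularity.Theorems

end
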